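import Summits.ResolutionOfSingularities.ResolutionOfSingularities.Theorems.HomologicalConductorNoZenoChartPrimeMaximal
import Summits.ResolutionOfSingularities.ResolutionOfSingularities.Theorems.HomologicalConductorNoZenoSpecResidueField
import Summits.ResolutionOfSingularities.ResolutionOfSingularities.Theorems.HomologicalConductorNoZenoSplitDataThread
import HarnessLib

/-!
# Crux `NoZenoR` / `NoZeno` (stmt-ResolutionOfSingularities-19943 / -16483) — slot 5 (B1) closer, (HALG): THE RESIDUE FIELD OF THE CHART
# GERM IS ALGEBRAIC OVER THE RESIDUE FIELD OF THE GERM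

Route `ResolutionOfSingularities/HomologicalConductor`, W4.4 chain, slot 5 `stub_L1wCoreF3`; the one by-signature input `halg` of (W-up)
`splitWeight_eq_one_of_sq` (`…NoZenoWeightUp`, res-L0-w44-stub-3 g14).  For the germ `T′ = T_P` (Noetherian local, dimension two), the chart
ring `B = k[T′ ∪ C·x⁻¹]`, its normalisation `N = nrm B` and a prime `𝔮 ⊂ N` with `dim N_𝔮 = 2` — so `𝔮` is MAXIMAL and `𝔮 ∩ T′ = 𝔪` ((G4),
res-D-pv-039 `ChartFibre.isMaximal_and_comap_eq_chart_set`, p569474) — the residue field `κ(N_𝔮) = N/𝔮` is ALGEBRAIC over `κ(T′) = T′/𝔪`: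
`B/(𝔮 ∩ B)` is a field of finite type over `κ(T′)`, hence finite (ZARISKI's lemma, Mathlib `finite_of_finite_type_of_isJacobsonRing`), and
`N/𝔮` is integral over it.

* §1 `Algebra.IsAlgebraic.of_equiv_equiv'` (transport along compatible isomorphisms of both fields);
* §2 `isAlgebraic_residueField_of_isLocalization_atPrime` — the ring-level statement for any tower `T → B → N`, `B` of finite type over the
  local `T`, `N` integral over `B`, `𝔮 ⊂ N` maximal over `𝔪_T`, `Rq = N_𝔮`;
* §3 `isAlgebraic_residueFieldMap_closedPoint` — the `Spec`-level form (`(Spec f).residueFieldMap (closedPoint)`), by res-L0-w44-stub-2's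
  `exists_residueFieldMap_compat`;
* §4 **`isAlgebraic_residueFieldMap_chartGerm`** — the supplier of `halg` in the literal `Sig.L1Core` / `exists_seam1Package` currency
  (`T P hP … C hCT x B hB 𝔮 h𝔮 D′ hD′ hEq hdim′`, any `f : T_P →+* D′` with `(f d : K) = d`).

Def-free, fact-free; `--supports 19943 --as helper`.  OURS (cell res-hironaka): AI-produced and kernel-checked, weaker than expert review;
nothing here is a statement of the manuscript under review (Hironaka 2017); counted 0.
-/

noncomputable section

-- single-problem summit: the doubled namespace component `ResolutionOfSingularities` is forced
set_option linter.dupNamespace false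

open CategoryTheory AlgebraicGeometry IsLocalRing
open Summit.ResolutionOfSingularities.ResolutionOfSingularities.Theorems.NoZeno.Birth
open Summit.ResolutionOfSingularities.ResolutionOfSingularities.Theorems.NoZeno.SandwichCluster
open Summit.ResolutionOfSingularities.ResolutionOfSingularities.Theorems.NoZeno.SandwichCluster.Parasite
  (locPrime isLocalRing_locPrime mem_locPrime_of_mem)
open Summit.ResolutionOfSingularities.ResolutionOfSingularities.Theorems.NoZeno.SandwichCluster.Thread
  (toSubring_le_locPrime isLocalization_locPrime)
open Summit.ResolutionOfSingularities.ResolutionOfSingularities.Theorems.NoZeno.SplittingBase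
  (locPrimeSubalgebra le_locPrimeSubalgebra)

namespace Summit.ResolutionOfSingularities.ResolutionOfSingularities.Theorems.NoZeno.ExcCount

/-! ## §1 Algebraicity along compatible isomorphisms -/

/-- **Algebraicity is transported along compatible isomorphisms of the base and of the top field.** [folklore] -/
theorem isAlgebraic_of_equiv_equiv {F₁ F₂ L₁ L₂ : Type*} [Field F₁] [Field F₂] [Field L₁] [Field L₂]
    [Algebra F₁ L₁] [Algebra F₂ L₂] (eF : F₁ ≃+* F₂) (eL : L₁ ≃+* L₂)
    (h : (algebraMap F₂ L₂).comp eF.toRingHom = eL.toRingHom.comp (algebraMap F₁ L₁))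
    [Algebra.IsAlgebraic F₂ L₂] : Algebra.IsAlgebraic F₁ L₁ := by
  refine ⟨fun x => ?_⟩
  obtain ⟨p, hp0, hpx⟩ := Algebra.IsAlgebraic.isAlgebraic (R := F₂) (eL x)
  refine ⟨p.map eF.symm.toRingHom, ?_, ?_⟩
  · exact (Polynomial.map_ne_zero_iff eF.symm.injective).mpr hp0
  · apply eL.injective
    have hid : eF.toRingHom.comp eF.symm.toRingHom = RingHom.id F₂ := by
      ext a; exact eF.apply_symm_apply a
    have hmap : eL (Polynomial.aeval x (p.map eF.symm.toRingHom)) = Polynomial.aeval (eL x) p := by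
      have hmap := Polynomial.map_aeval_eq_aeval_map h (p.map eF.symm.toRingHom) x
      rw [Polynomial.map_map, hid, Polynomial.map_id] at hmap
      exact hmap
    rw [hmap, hpx, map_zero]

/-! ## §2 Ring level: `κ(N_𝔮)` is algebraic over `κ(T)` -/

/-- **`κ(N_𝔮)/κ(T)` is algebraic.**  `T` local, `B` a `T`-algebra of finite type, `N` integral over `B`, `𝔮 ⊂ N` maximal with
`𝔮 ∩ T = 𝔪_T`, `Rq = N_𝔮`, the structure map `T → Rq` local: then `ResidueField Rq ≅ N/𝔮 ⊇ B/(𝔮 ∩ B) ⊇ T/𝔪`, the first step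
integral and the second FINITE by Zariski's lemma. [folklore] -/
theorem isAlgebraic_residueField_of_isLocalization_atPrime {T B N Rq : Type*} [CommRing T] [CommRing B] [CommRing N]
    [CommRing Rq] [IsLocalRing T] [IsLocalRing Rq] [Algebra T B] [Algebra B N] [Algebra T N] [IsScalarTower T B N]
    [Algebra.FiniteType T B] [Algebra.IsIntegral B N] (𝔮 : Ideal N) [𝔮.IsMaximal]
    (h𝔮T : 𝔮.under T = maximalIdeal T) [Algebra N Rq] [IsLocalization.AtPrime Rq 𝔮] [Algebra T Rq]
    [IsScalarTower T N Rq] [IsLocalHom (algebraMap T Rq)] :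
    Algebra.IsAlgebraic (ResidueField T) (ResidueField Rq) := by
  haveI : 𝔮.LiesOver (𝔮.under B) := ⟨rfl⟩
  haveI : (𝔮.under B).LiesOver (maximalIdeal T) := ⟨by rw [Ideal.under_under]; exact h𝔮T.symm⟩
  haveI : 𝔮.LiesOver (maximalIdeal T) := ⟨h𝔮T.symm⟩
  letI := Ideal.Quotient.field (𝔮.under B)
  letI := Ideal.Quotient.field 𝔮
  letI : Algebra (ResidueField T) (B ⧸ 𝔮.under B) := Ideal.Quotient.algebraOfLiesOver (𝔮.under B) (maximalIdeal T)
  letI : Algebra (ResidueField T) (N ⧸ 𝔮) := Ideal.Quotient.algebraOfLiesOver 𝔮 (maximalIdeal T)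
  haveI : IsScalarTower T (ResidueField T) (B ⧸ 𝔮.under B) :=
    Ideal.Quotient.isScalarTower_of_liesOver T (𝔮.under B) (maximalIdeal T)
  -- `B/(𝔮 ∩ B)` is finite over `κ(T)` (Zariski)
  haveI : Algebra.FiniteType (ResidueField T) (B ⧸ 𝔮.under B) :=
    Algebra.FiniteType.of_restrictScalars_finiteType T _ _
  haveI : Module.Finite (ResidueField T) (B ⧸ 𝔮.under B) := finite_of_finite_type_of_isJacobsonRing _ _
  haveI : Algebra.IsAlgebraic (ResidueField T) (B ⧸ 𝔮.under B) := Algebra.IsAlgebraic.of_finite _ _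
  -- `N/𝔮` is integral over it, hence algebraic over `κ(T)`
  haveI : IsScalarTower (ResidueField T) (B ⧸ 𝔮.under B) (N ⧸ 𝔮) := by
    refine IsScalarTower.of_algebraMap_eq fun c => ?_
    obtain ⟨t, rfl⟩ := Ideal.Quotient.mk_surjective c
    change Ideal.Quotient.mk 𝔮 (algebraMap T N t) =
      Ideal.Quotient.mk 𝔮 (algebraMap B N (algebraMap T B t))
    rw [IsScalarTower.algebraMap_apply T B N t]
  have hN : Algebra.IsAlgebraic (ResidueField T) (N ⧸ 𝔮) :=
    Algebra.IsAlgebraic.trans_isIntegral (ResidueField T) (B ⧸ 𝔮.under B) (N ⧸ 𝔮)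
  -- `ResidueField Rq ≅ N/𝔮` over `κ(T)`
  let eₐ : (N ⧸ 𝔮) ≃ₐ[ResidueField T] ResidueField Rq :=
    { IsLocalization.AtPrime.equivQuotMaximalIdeal 𝔮 Rq with
      commutes' := fun c => by
        obtain ⟨t, rfl⟩ := Ideal.Quotient.mk_surjective c
        change IsLocalization.AtPrime.equivQuotMaximalIdeal 𝔮 Rq (Ideal.Quotient.mk 𝔮 (algebraMap T N t)) =
          residue Rq (algebraMap T Rq t)
        rw [IsLocalization.AtPrime.equivQuotMaximalIdeal_apply_mk, ← IsScalarTower.algebraMap_apply]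
        rfl }
  exact eₐ.isAlgebraic_iff.mp hN

/-! ## §3 `Spec` level -/

/-- **The residue field map of `Spec S → Spec R` at the closed point is algebraic** as soon as `ResidueField S` is algebraic over
`ResidueField R` (the isomorphisms of res-L0-w44-stub-2's `exists_residueFieldMap_compat`). [folklore] -/
theorem isAlgebraic_residueFieldMap_closedPoint (R S : Type) [CommRing R] [CommRing S] [IsLocalRing R] [IsLocalRing S]
    [Algebra R S] [IsLocalHom (algebraMap R S)] [Algebra.IsAlgebraic (ResidueField R) (ResidueField S)] :
    letI := ((Spec.map (CommRingCat.ofHom (algebraMap R S))).residueFieldMap (closedPoint S)).hom.toAlgebra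
    Algebra.IsAlgebraic ((Spec (.of R)).residueField ((Spec.map (CommRingCat.ofHom (algebraMap R S))).base
      (closedPoint S))) ((Spec (.of S)).residueField (closedPoint S)) := by
  obtain ⟨eR, eS, h⟩ := exists_residueFieldMap_compat R S
  letI := ((Spec.map (CommRingCat.ofHom (algebraMap R S))).residueFieldMap (closedPoint S)).hom.toAlgebra
  refine isAlgebraic_of_equiv_equiv eR.commRingCatIsoToRingEquiv eS.commRingCatIsoToRingEquiv ?_
  ext a
  have h' := congrArg (fun φ => φ.hom a) h
  simp only [CommRingCat.hom_comp, RingHom.comp_apply, CommRingCat.hom_ofHom] at h'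
  change algebraMap (ResidueField R) (ResidueField S) (eR.hom.hom a) =
    eS.hom.hom (((Spec.map (CommRingCat.ofHom (algebraMap R S))).residueFieldMap (closedPoint S)).hom a)
  exact h'.symm

/-! ## §4 The supplier of `halg` for the chart germ -/

variable {k K : Type} [Field k] [Field K] [Algebra k K]

/-- **The residue field of the chart germ is algebraic over that of the base germ** — generic form: `T' ⊆ K` a Noetherian local
`k`-subalgebra of dimension two with `Frac T' = K`, `C ⊆ T'`, `x ∈ K`, `B = k[T' ∪ C·x⁻¹]`, `𝔮 ⊂ nrm B` prime with `D′ = (nrm B)_𝔮` local of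
dimension two, `f : T' → D′` the inclusion. [folklore] -/
theorem isAlgebraic_residueFieldMap_chart (T' : Subalgebra k K) [IsLocalRing ↥T'] [IsNoetherianRing ↥T']
    [IsFractionRing ↥T' K] (hdim : ringKrullDim ↥T' = 2)
    (C : Set K) (hCT : C ⊆ (T' : Set K)) (x : K) (B : Subalgebra k K)
    (hB : B = Algebra.adjoin k ((T' : Set K) ∪ {y : K | ∃ c ∈ C, y = c * x⁻¹}))
    (𝔮 : Ideal ↥(nrm B)) (h𝔮 : 𝔮.IsPrime) (D' : Subring K) (hD' : IsLocalRing ↥D')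
    (hEq : locPrime (nrm B) 𝔮 h𝔮 = D') (hdim' : ringKrullDim ↥D' = 2)
    (f : ↥T' →+* ↥D') (hf : ∀ d, ((f d : ↥D') : K) = (d : K)) :
    letI := hD'
    letI := ((Spec.map (CommRingCat.ofHom f)).residueFieldMap (closedPoint ↥D')).hom.toAlgebra
    Algebra.IsAlgebraic ((Spec (.of ↥T')).residueField
      ((Spec.map (CommRingCat.ofHom f)).base (closedPoint ↥D'))) ((Spec (.of ↥D')).residueField (closedPoint ↥D')) := by
  classical
  subst hEq
  subst hB
  have hTB : T' ≤ Algebra.adjoin k ((T' : Set K) ∪ {y : K | ∃ c ∈ C, y = c * x⁻¹}) :=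
    fun y hy => Algebra.subset_adjoin (Or.inl hy)
  have hBN : Algebra.adjoin k ((T' : Set K) ∪ {y : K | ∃ c ∈ C, y = c * x⁻¹}) ≤
      nrm (Algebra.adjoin k ((T' : Set K) ∪ {y : K | ∃ c ∈ C, y = c * x⁻¹})) :=
    SyzygyFlattening.self_le_nrm _
  have hTN := hTB.trans hBN
  -- (G4): `𝔮` is maximal and contracts to `𝔪`
  obtain ⟨h𝔮max, h𝔪⟩ := ChartFibre.isMaximal_and_comap_eq_chart_set T' hdim hCT x hTN 𝔮 h𝔮 hdim'
  haveI := h𝔮max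
  -- the tower `T' → B → N → D'`
  letI algTB : Algebra ↥T' ↥(Algebra.adjoin k ((T' : Set K) ∪ {y : K | ∃ c ∈ C, y = c * x⁻¹})) :=
    (Subalgebra.inclusion hTB).toRingHom.toAlgebra
  letI algBN : Algebra ↥(Algebra.adjoin k ((T' : Set K) ∪ {y : K | ∃ c ∈ C, y = c * x⁻¹}))
      ↥(nrm (Algebra.adjoin k ((T' : Set K) ∪ {y : K | ∃ c ∈ C, y = c * x⁻¹}))) :=
    (Subalgebra.inclusion hBN).toRingHom.toAlgebra
  letI algTN : Algebra ↥T' ↥(nrm (Algebra.adjoin k ((T' : Set K) ∪ {y : K | ∃ c ∈ C, y = c * x⁻¹}))) :=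
    (Subalgebra.inclusion hTN).toRingHom.toAlgebra
  haveI : IsScalarTower ↥T' ↥(Algebra.adjoin k ((T' : Set K) ∪ {y : K | ∃ c ∈ C, y = c * x⁻¹}))
      ↥(nrm (Algebra.adjoin k ((T' : Set K) ∪ {y : K | ∃ c ∈ C, y = c * x⁻¹}))) :=
    IsScalarTower.of_algebraMap_eq fun _ => Subtype.ext rfl
  haveI : IsScalarTower k ↥T' ↥(Algebra.adjoin k ((T' : Set K) ∪ {y : K | ∃ c ∈ C, y = c * x⁻¹})) :=
    IsScalarTower.of_algebraMap_eq fun _ => Subtype.ext rfl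
  -- `B` is of finite type over `T'`: generated by `d·x⁻¹` for finitely many generators `d` of `(C)·T'`
  obtain ⟨s, hs⟩ : (Ideal.span {d : ↥T' | (d : K) ∈ C}).FG := IsNoetherian.noetherian _
  have hsB : ∀ d ∈ s, (d : K) * x⁻¹ ∈ Algebra.adjoin k ((T' : Set K) ∪ {y : K | ∃ c ∈ C, y = c * x⁻¹}) := by
    intro d hd
    have hd' : d ∈ Ideal.span {d : ↥T' | (d : K) ∈ C} := hs ▸ Ideal.subset_span hd
    exact ChartFibre.mul_inv_mem_of_mem_span T' {d : ↥T' | (d : K) ∈ C} x hTB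
      (fun g hg => Algebra.subset_adjoin (Or.inr ⟨(g : K), hg, rfl⟩)) hd'
  have hBF : Algebra.adjoin k ((T' : Set K) ∪ {y : K | ∃ c ∈ C, y = c * x⁻¹}) ≤
      Algebra.adjoin k ((T' : Set K) ∪ ((s.image fun d : ↥T' => (d : K) * x⁻¹ : Finset K) : Set K)) := by
    refine Algebra.adjoin_le ?_
    rintro y (hy | ⟨c, hc, rfl⟩)
    · exact Algebra.subset_adjoin (Or.inl hy)
    · have hcG : (⟨c, hCT hc⟩ : ↥T') ∈ Ideal.span {d : ↥T' | (d : K) ∈ C} :=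
        Ideal.subset_span (show ((⟨c, hCT hc⟩ : ↥T') : K) ∈ C from hc)
      rw [← hs] at hcG
      refine ChartFibre.mul_inv_mem_of_mem_span T' (s : Set ↥T') x
        (fun z hz => Algebra.subset_adjoin (Or.inl hz)) (fun g hg => ?_) hcG
      refine Algebra.subset_adjoin (Or.inr ?_)
      rw [Finset.coe_image]
      exact ⟨g, hg, rfl⟩
  haveI : Algebra.FiniteType ↥T' ↥(Algebra.adjoin k ((T' : Set K) ∪ {y : K | ∃ c ∈ C, y = c * x⁻¹})) := by
    refine ⟨⟨(s.image fun d : ↥T' => (d : K) * x⁻¹).attach.image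
      (fun y => (⟨y.1, by
        obtain ⟨d, hd, hdy⟩ := Finset.mem_image.mp y.2
        rw [← hdy]; exact hsB d hd⟩ :
          ↥(Algebra.adjoin k ((T' : Set K) ∪ {y : K | ∃ c ∈ C, y = c * x⁻¹})))), ?_⟩⟩
    refine eq_top_iff.mpr fun y _ => ?_
    have hle : Algebra.adjoin k ((T' : Set K) ∪ {y : K | ∃ c ∈ C, y = c * x⁻¹}) ≤
        ((Algebra.adjoin ↥T'
          (((s.image fun d : ↥T' => (d : K) * x⁻¹).attach.image
            (fun y => (⟨y.1, by
              obtain ⟨d, hd, hdy⟩ := Finset.mem_image.mp y.2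
              rw [← hdy]; exact hsB d hd⟩ :
                ↥(Algebra.adjoin k ((T' : Set K) ∪ {y : K | ∃ c ∈ C, y = c * x⁻¹})))) :
            Finset _) : Set _)).restrictScalars k).map
          (Algebra.adjoin k ((T' : Set K) ∪ {y : K | ∃ c ∈ C, y = c * x⁻¹})).val := by
      refine hBF.trans (Algebra.adjoin_le ?_)
      rintro z (hz | hz)
      · exact ⟨⟨z, hTB hz⟩, Subalgebra.algebraMap_mem _ (⟨z, hz⟩ : ↥T'), rfl⟩
      · refine ⟨⟨z, ?_⟩, Algebra.subset_adjoin ?_, rfl⟩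
        · obtain ⟨d, hd, hdz⟩ := Finset.mem_image.mp (Finset.mem_coe.mp hz)
          rw [← hdz]; exact hsB d hd
        · rw [Finset.coe_image]
          exact ⟨⟨z, Finset.mem_coe.mp hz⟩, Finset.mem_coe.mpr (Finset.mem_attach _ _), rfl⟩
    obtain ⟨w, hw, hwy⟩ := hle y.2
    have hwy' : w = y := Subtype.ext hwy
    rw [← hwy']
    exact hw
  -- `N = nrm B` is integral over `B`
  let ιN : ↥(nrm (Algebra.adjoin k ((T' : Set K) ∪ {y : K | ∃ c ∈ C, y = c * x⁻¹})))
      →ₐ[↥(Algebra.adjoin k ((T' : Set K) ∪ {y : K | ∃ c ∈ C, y = c * x⁻¹}))] K :=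
    { toRingHom := (nrm (Algebra.adjoin k ((T' : Set K) ∪ {y : K | ∃ c ∈ C, y = c * x⁻¹}))).val.toRingHom
      commutes' := fun _ => rfl }
  haveI : Algebra.IsIntegral ↥(Algebra.adjoin k ((T' : Set K) ∪ {y : K | ∃ c ∈ C, y = c * x⁻¹}))
      ↥(nrm (Algebra.adjoin k ((T' : Set K) ∪ {y : K | ∃ c ∈ C, y = c * x⁻¹}))) :=
    ⟨fun y => (isIntegral_algHom_iff ιN Subtype.val_injective).mp (ChartFibre.isIntegral_of_mem_nrm _ y.2)⟩
  -- `D' = N_𝔮` as an algebra over `N` and over `T'` (through `f`)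
  letI algND : Algebra ↥(nrm (Algebra.adjoin k ((T' : Set K) ∪ {y : K | ∃ c ∈ C, y = c * x⁻¹})))
      ↥(locPrime (nrm (Algebra.adjoin k ((T' : Set K) ∪ {y : K | ∃ c ∈ C, y = c * x⁻¹}))) 𝔮 h𝔮) :=
    (Subring.inclusion (toSubring_le_locPrime (nrm _) 𝔮 h𝔮)).toAlgebra
  haveI := isLocalization_locPrime (nrm (Algebra.adjoin k ((T' : Set K) ∪ {y : K | ∃ c ∈ C, y = c * x⁻¹}))) 𝔮 h𝔮
  letI algTD : Algebra ↥T'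
      ↥(locPrime (nrm (Algebra.adjoin k ((T' : Set K) ∪ {y : K | ∃ c ∈ C, y = c * x⁻¹}))) 𝔮 h𝔮) :=
    f.toAlgebra
  haveI : IsScalarTower ↥T' ↥(nrm (Algebra.adjoin k ((T' : Set K) ∪ {y : K | ∃ c ∈ C, y = c * x⁻¹})))
      ↥(locPrime (nrm (Algebra.adjoin k ((T' : Set K) ∪ {y : K | ∃ c ∈ C, y = c * x⁻¹}))) 𝔮 h𝔮) :=
    IsScalarTower.of_algebraMap_eq fun t => Subtype.ext (hf t)
  haveI := hD'
  haveI : IsLocalHom (algebraMap ↥T'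
      ↥(locPrime (nrm (Algebra.adjoin k ((T' : Set K) ∪ {y : K | ∃ c ∈ C, y = c * x⁻¹}))) 𝔮 h𝔮)) := by
    refine ⟨fun t ht => ?_⟩
    by_contra hnu
    have htm : t ∈ maximalIdeal ↥T' := (IsLocalRing.mem_maximalIdeal t).mpr hnu
    rw [← h𝔪, Ideal.mem_comap] at htm
    have hmem : algebraMap ↥T' ↥(locPrime (nrm (Algebra.adjoin k ((T' : Set K) ∪
        {y : K | ∃ c ∈ C, y = c * x⁻¹}))) 𝔮 h𝔮) t ∈ maximalIdeal _ := by
      rw [IsScalarTower.algebraMap_apply ↥T' ↥(nrm (Algebra.adjoin k ((T' : Set K) ∪ {y : K | ∃ c ∈ C, y = c * x⁻¹})))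
        ↥(locPrime (nrm (Algebra.adjoin k ((T' : Set K) ∪ {y : K | ∃ c ∈ C, y = c * x⁻¹}))) 𝔮 h𝔮) t]
      exact (IsLocalization.AtPrime.to_map_mem_maximal_iff _ 𝔮 _).mpr htm
    exact (IsLocalRing.mem_maximalIdeal _).mp hmem ht
  have h𝔮T : 𝔮.under ↥T' = maximalIdeal ↥T' := h𝔪
  haveI := isAlgebraic_residueField_of_isLocalization_atPrime (T := ↥T')
    (B := ↥(Algebra.adjoin k ((T' : Set K) ∪ {y : K | ∃ c ∈ C, y = c * x⁻¹})))
    (N := ↥(nrm (Algebra.adjoin k ((T' : Set K) ∪ {y : K | ∃ c ∈ C, y = c * x⁻¹}))))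
    (Rq := ↥(locPrime (nrm (Algebra.adjoin k ((T' : Set K) ∪ {y : K | ∃ c ∈ C, y = c * x⁻¹}))) 𝔮 h𝔮))
    𝔮 h𝔮T
  exact isAlgebraic_residueFieldMap_closedPoint ↥T'
    ↥(locPrime (nrm (Algebra.adjoin k ((T' : Set K) ∪ {y : K | ∃ c ∈ C, y = c * x⁻¹}))) 𝔮 h𝔮)

/-- **(HALG) in the literal `Sig.L1Core` / `exists_seam1Package` binders**: `T_P` (`T` essentially of finite type over `k`, `Frac T = K`,
`dim T_P = 2`), `C ⊆ T`, `x ∈ K`, `B = k[T_P ∪ C·x⁻¹]`, `𝔮 ⊂ nrm B` prime, `D′ = (nrm B)_𝔮` local of dimension two, and `f : T_P → D′`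
with `(f d : K) = d`: `κ(D′)` is algebraic over `κ(T_P)` through `(Spec f).residueFieldMap (closedPoint D′)` — the binder `halg` of
`splitWeight_eq_one_of_sq`. [folklore] -/
theorem isAlgebraic_residueFieldMap_chartGerm (T : Subalgebra k K) (P : Ideal ↥T) (hP : P.IsPrime)
    [Algebra.EssFiniteType k ↥T] [IsFractionRing ↥T K] (hdim : ringKrullDim ↥(locPrime T P hP) = 2)
    (C : Set K) (hCT : C ⊆ (T : Set K)) (x : K) (B : Subalgebra k K)
    (hB : B = Algebra.adjoin k ((locPrime T P hP : Set K) ∪ {y : K | ∃ c ∈ C, y = c * x⁻¹}))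
    (𝔮 : Ideal ↥(nrm B)) (h𝔮 : 𝔮.IsPrime) (D' : Subring K) (hD' : IsLocalRing ↥D')
    (hEq : locPrime (nrm B) 𝔮 h𝔮 = D') (hdim' : ringKrullDim ↥D' = 2)
    (f : ↥(locPrime T P hP) →+* ↥D') (hf : ∀ d, ((f d : ↥D') : K) = (d : K)) :
    letI := hD'
    letI := ((Spec.map (CommRingCat.ofHom f)).residueFieldMap (closedPoint ↥D')).hom.toAlgebra
    Algebra.IsAlgebraic ((Spec (.of ↥(locPrime T P hP))).residueField
      ((Spec.map (CommRingCat.ofHom f)).base (closedPoint ↥D'))) ((Spec (.of ↥D')).residueField (closedPoint ↥D')) := by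
  haveI : IsNoetherianRing ↥T := Algebra.EssFiniteType.isNoetherianRing k ↥T
  haveI : IsLocalRing ↥(locPrimeSubalgebra T P hP) := isLocalRing_locPrime T P hP
  have hCT' : C ⊆ ((locPrimeSubalgebra T P hP : Subalgebra k K) : Set K) :=
    fun c hc => le_locPrimeSubalgebra T P hP (hCT hc)
  exact isAlgebraic_residueFieldMap_chart (locPrimeSubalgebra T P hP) hdim C hCT' x B hB 𝔮 h𝔮 D' hD' hEq hdim' f hf

end Summit.ResolutionOfSingularities.ResolutionOfSingularities.Theorems.NoZeno.ExcCount

end
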